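import Mathlib

/-!
# `Balaban1983to89.B9Eq386Neumann` — B9, p. 407: «Combining the expansions (3.71), (3.76) and (3.80) we get (3.82)», «We can
# write (3.82) as (3.84)» and «hence V(A)G(U) is a small operator in supremum norm, and we have (3.86) and convergence is in the
# operator norm» MADE HONEST: the ring algebra of (3.76)/(3.82)/(3.84) with `P₁(A)`, `V₃(A)`, `P₂(A)`, `V(A)` EXPLICIT, the
# inverse property of `G(U)` the factorisation (3.84) silently uses made a HYPOTHESIS (with a witness that it is needed), and
# the Neumann series (3.86) in a normed ring — existence, both printed equalities, two-sided inverse, uniqueness, norm and tail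
# bounds, «α₁ sufficiently small» as an explicit threshold; kernel-checked; v1

CITATION HEADER (lean-in-tree rule).  Audit cell `pub-balaban`, surge node-prover lineage pv27 (B9 §3: expansions of the
operators of the effective action in the fluctuation field `A` around the background `U`, pp. 404–407), unit
`b2b-balaban-pv27-g19` (journal CLAIM l.59243, node B9-EQ386-NEUMANN; fifth node of the seat, after `B9Eq375Composition`
(p191250/p191719), `B9Eq375Locality` (p191610/p191722), `B9Eq372Operator` (p192240/p192387), `B9Eq380Telescope` (p192580)).
B9 = T. Bałaban, *Propagators for lattice gauge theories in a background field*, Commun. Math. Phys. **99**, 389–434 (1985)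
[Balaban1985BackgroundPropagators] (journal page = PDF page + 388).  Every quotation below was read by this seat (2026-08-19)
from the x2 page renders `b2b-balaban-ref1/pages/1985-cmp99-background-propagators/1985-cmp99-background-propagators-pNNN-x2.png`
(p015 = p. 403, p016 = p. 404, p017 = p. 405, p019 = p. 407, p007 = p. 395, p004 = p. 392) AS IMAGES, not from an OCR layer.
What is reproduced: ONLY the bookkeeping the quoted sentences rely on — identities in a (noncommutative) ring and the
geometric series in a normed ring —, with every analytic input ((3.71), (3.75), (3.68), (3.80) as operator identities; the
bounds (3.73), (3.77), (3.83), (3.85); Theorem 3.3) a HYPOTHESIS (binder) where it is used at all, never a fact.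

ABSOLUTE RULE of the cell, honoured: no internally-minted statement enters as a cited fact.  Every declaration below is PROVED
(`[folklore]`: elementary algebra/analysis once the letters are fixed; the `[cite: …]` tags are LOCATORS of the printed
sentence a declaration makes honest, not appeals to it).  Imports: Mathlib only.  The operators `P(U)`, `P′(A)`, `P₁(A)` (the
projection `P = I − R` and its expansion (3.68); lineage r1/b10) appear ONLY as binders with the printed identities as
hypotheses; nothing of `B9.lean` (b09: `SectBStepPrinted`, `thm34_of_sectB` — Theorem 3.4 by reference) is imported or restated:
this leaf is the kernel side of the MECHANISM of the (3.82)–(3.86) step, not a statement of Theorem 3.4.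

WHAT IS IN PRINT (verbatim).  p. 403 [PDF 15]: «These results imply that the operators R(U), P(U) = I − R(U) extend analytically
to the domain (3.37) and satisfy the same bounds, e.g. the operator P(U′U) satisfies the bounds (3.49). Moreover we have
P(U′U) = P(U) + P′(A), … (3.68)».  p. 404 [PDF 16]: «Let us consider at first the operator Δ(U′U). It is a sum of two operators,
Δ(U′U) = D*_{U′U}D_{U′U} + Δ′(U′U).»  p. 405 [PDF 17], after (3.75) («= (DD*A′)_μ(x) − (V₂(A)A′)_μ(x), (3.75) where the operators
F_{2,k}(A), V₂(A) satisfy the bounds (3.72), (3.73)»): «These expansions imply the following one: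
D_{U′U}R(U′U)D*_{U′U} = D_UR(U)D*_U − V₂(A) − (D_{U′U} − D_U)P(U)D*_U − D_UP(U)(D*_{U′U} − D*_U)
                      − (D_{U′U} − D_U)P(U)(D*_{U′U} − D*_U) − D_{U′U}P′(A)D*_{U′U} = DRD* − V₂(A) − P₁(A),  (3.76)».
p. 395 [PDF 7]: «We define Δ^η_a(U) = Δ^η(U) + D^η_UR(U)D^{η*}_U + Q*(U)aQ(U), (3.26) or simply Δ_a = Δ + DRD* + Q*aQ. … we will need
Δ_a with Dirichlet boundary conditions on Ω^c_0, thus Δ_a↾_{Ω₀} = Ω₀Δ_aΩ₀, and we denote its inverse again by G, or G(U), if we need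
to stress explicitly the dependence on the configuration U, G(U) = G = (Δ_a↾_{Ω₀})^{−1}. (3.27)».  p. 407 [PDF 19]: «Combining the
expansions (3.71), (3.76) and (3.80) we get
Δ_a(U′U) = D*_{U′U}D_{U′U} + Δ′(U′U) + D_{U′U}R(U′U)D*_{U′U} + Q*(U′U)aQ(U′U)
         = Δ_a(U) − V₁(A) + (Δ′(U′U) − Δ′(U)) − V₂(A) − P₁(A) + F₂*(A)aQ(U) + Q*(U)aF₂(A) + F₂*(A)aF₂(A)
         = Δ_a(U) − V₃(A) − P₁(A) − P₂(A).  (3.82)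
The operator V₃(A) is a local differential operator of the first order satisfying the bound (3.73). The operator P₁(A) was
defined in (3.76). It is a non-local bounded operator and satisfies the bound (3.77). The operator P₂(A) is a sum of three terms
obtained by the expansion of averaging operators. It is a semi-local operator in the sense that the value (P₂(A)A′)(b) at a bond
b ∈ B^j(Λ_j) depends on A, A′ restricted to j-blocks neighbouring the block containing the bond b. It satisfies the bound
|(P₂(A)A′)(b)| ≤ O(1)α₁(L^jη)^{−2}|A′|, b ∈ B^j(Λ_j), (3.83) with the norm |A′| restricted to the blocks defined above. The operators
V₃(A), P₁(A), P₂(A) depend analytically on A in the domain (3.37). Let us denote the sum of these three operators by V(A). We can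
write (3.82) as  Δ_a(U′U) = Δ_a(U) − V(A) = (I − V(A)G(U))Δ_a(U).  (3.84)  Using the bounds (3.73), (3.77), (3.83) and assuming that
Theorem 3.3 holds for G(U), we get |(V(A)G(U)J)(b)| ≤ O(1)α₁e^{−(1/2)δ₀d(y,y′)}|J| for b ∈ Δ(y), supp J ⊂ Δ(y′). (3.85) (Here J is an
arbitrary gauge field configuration with values in g^c.) This bound implies in particular the bound |V(A)G(U)J| ≤ O(1)α₁|J|, hence
V(A) G(U) is a small operator in supremum norm, and we have  G(U′U) = G(U)(I − V(A)G(U))^{−1} = Σ_{n=0}^∞ G(U)(V(A)G(U))^n,  (3.86)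
and convergence is in the operator norm for α₁ sufficiently mall [sic]. Each term in the series is an analytic function of A in
the domain (3.37). Theorem (3.3) implies also convergence in all norms appearing in its formulation, thus in all norms on the
left-hand sides of the inequalities (3.42)–(3.47). This way we get all these inequalities for the operator G(U′U), the local ones
follow from the bound (3.85) and Lemma 2.1 [4]. Thus Theorem 3.4 is proved, assuming that Theorems 3.1–3.3 hold.»

READING / MODEL.  All operators of the paragraph act on `g^c`-valued gauge-field configurations on (the bonds of) `Ω₀` — the
Dirichlet restriction `X ↦ Ω₀XΩ₀` of (3.27) is ADDITIVE (`compress_sub`), so the difference identity «Δ_a(U′U) = Δ_a(U) − V(A)»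
descends to the restricted operators, and `G(U) = (Δ_a(U)↾_{Ω₀})^{−1}` is the inverse IN THE RING OF OPERATORS ON FUNCTIONS ON Ω₀.
This file therefore works in ONE ring `R` (any ring for §1–§2; a normed ring with summable geometric series — every complete
normed ring, in particular `E →L[𝕜] E` for a Banach space `E` — for §3; continuous linear operators for §4), in which EVERY
operator of the print is a BINDER: `D = D_U`, `D′ = D_{U′U}`, `Ds = D*_U`, `Ds′ = D*_{U′U}`, `Rr = R(U)`, `Rr′ = R(U′U)`, `P = P(U)`,
`Pp = P′(A)`, `DsD = D*_UD_U`, `Δp = Δ′(U)`, `DRDs = D_UR(U)D*_U`, `Q, Qs, Q′, Qs′ = Q(U), Q*(U), Q(U′U), Q*(U′U)`, `F₂, F₂s =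
F₂(A), F₂*(A)` (= `F_{2,j}`, `F*_{2,j}` of (3.80); NOT adjoints of each other for complex `A`, as the print notes — hence two
binders), `V₁, V₂ = V₁(A), V₂(A)`, `a` = the constant `a`, `G = G(U)`, `V = V(A)`.  The printed identities (3.71) «D*_{U′U}D_{U′U} =
D*D − V₁(A)», (3.75) «D_{U′U}D*_{U′U} = DD* − V₂(A)», «P(U) = I − R(U)» at `U` and at `U′U`, (3.68) and (3.80) «Q(U′U) = Q(U) +
F₂(A)», «Q*(U′U) = Q*(U) + F₂*(A)» enter as HYPOTHESES `h371`, `h375`, `hR`, `hR′`, `h380`, `h380s` (their kernel versions on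
a concrete carrier are `B9Eq372Operator.lapDDL_prodCfg` / `gradDivL_prodCfg` and `B9Eq380Telescope.prodDesc_telescope`; not
imported — the point here is the assembly).  HIDDEN HYPOTHESIS MADE EXPLICIT: the second equality of (3.84), «Δ_a(U) − V(A) =
(I − V(A)G(U))Δ_a(U)», uses `G(U)Δ_a(U) = I` (LEFT inverse), and «(Δ_a − V)G(U′U) = I» uses `Δ_a(U)G(U) = I` (RIGHT inverse);
both hold for THE inverse (3.27), and the factorisation is false for a general `G` (`eq384_factor_needs_inverse`: integers
`Δ_a = 2`, `V = 1`, `G = 0`).  SIGN CONVENTION: the print defines `V₃`, `P₂` only through the third equality of (3.82); the kernel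
takes `V₃(A) := V₁(A) − (Δ′(U′U) − Δ′(U)) + V₂(A)` and `P₂(A) := −(F₂*(A)aQ(U) + Q*(U)aF₂(A) + F₂*(A)aF₂(A))` («a sum of three terms
obtained by the expansion of averaging operators», with the sign that makes the third equality an identity), `V(A) := V₃ + P₁ +
P₂`.  No print/kernel divergence was found in this paragraph («sufficiently mall» is a typo).

WHAT THIS FILE PROVES (no analytic input used; every threshold explicit).
* §1 (3.76): both printed equalities, from (3.75), `R = 1 − P` (at `U` and `U′U`) and (3.68), with
  `P₁(A) := (D′−D)P D* + D P(D′*−D*) + (D′−D)P(D′*−D*) + D′P′(A)D′*` (`pOne`) — `eq376_line1`, `eq376`.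
* §2 (3.82)/(3.84): `Δ_a := D*D + Δ′ + DRD* + Q*aQ` ((3.26) with «Δ = D*D + Δ′», `deltaA`); the three printed lines of (3.82)
  (`eq382_line1`, `eq382_line2`, `eq382`), «Δ_a(U′U) = Δ_a(U) − V(A)» (`eq384_sub`), the factorisation «= (I − V(A)G(U))Δ_a(U)»
  GIVEN `GΔ_a = 1` (`eq384_factor`; right twin `eq384_factor_right`; necessity witness `eq384_factor_needs_inverse`), and
  `(Δ_a − V)G = 1 − VG` given `Δ_aG = 1` (`sub_mul_G`).
* §3 (3.86) in a normed ring `R` (`gNew G V := G·Σ'_n (VG)^n`): for `‖VG‖ < 1` and `R` with summable geometric series —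
  `G·Σ(VG)^n = Σ G(VG)^n` (`gNew_eq_tsum`), CONVERGENCE IN THE NORM OF `R` (`hasSum_gNew`, `tendsto_partialSums`; geometric tail
  `gNew_sub_partial`, `norm_gNew_sub_partial_le`), `= G(I − VG)^{−1}` as a unit / `Ring.inverse` (`gNew_eq_mul_unit_inv`,
  `gNew_eq_mul_inverse`, `unit_val`), `(Δ_a − V)·gNew = 1` given `Δ_aG = 1` (`sub_mul_gNew`), `gNew·(Δ_a − V) = 1` given `GΔ_a = 1`
  (`gNew_mul_sub`), hence `Δ_a − V` is a unit and ANY one-sided inverse of it is `gNew` (`isUnit_sub`, `leftInverse_eq_gNew`,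
  `rightInverse_eq_gNew`, `inverse_sub_eq_gNew`) — so «G(U′U)», THE inverse of `Δ_a(U′U)` (3.27), IS the series; (3.86) in its
  literal shape `(Δ_a − V)^{−1} = Δ_a^{−1}(1 − VΔ_a^{−1})^{−1}` (`eq386_inverse_form`); the resolvent identity `gNew − G = G V gNew` and
  the first-order closeness `‖gNew − G‖ ≤ ‖G‖‖VG‖(‖1‖ − 1 + (1 − ‖VG‖)⁻¹)` (`gNew_sub_G`, `norm_gNew_sub_G_le`); the norm bound
  `‖gNew‖ ≤ ‖G‖(‖1‖ − 1 + (1 − ‖VG‖)⁻¹)`, `≤ ‖G‖/(1 − ‖VG‖)` when `‖1‖ ≤ 1` (`norm_gNew_le`, `norm_gNew_le_of_norm_one_le`,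
  `norm_gNew_le'`); «α₁ sufficiently small» EXPLICIT: `‖VG‖ ≤ cα₁` and `cα₁ < 1` (e.g. `α₁ < c⁻¹`, `mul_lt_one_of_lt_inv`) give
  `‖VG‖ < 1` (`norm_lt_one_of_le_mul`).
* §4 continuous linear operators on a normed space `E` over `𝕜`: the pointwise bound «|V(A)G(U)J| ≤ O(1)α₁|J|» for all `J` gives
  the operator-norm bound `‖VG‖ ≤ O(1)α₁` (`opNorm_le_of_pointwise`, `opNorm_lt_one_of_pointwise`), `‖1‖ ≤ 1` hence
  `‖gNew‖ ≤ ‖G‖/(1 − ‖VG‖)` and `‖gNew J‖ ≤ ‖G‖/(1 − ‖VG‖)·‖J‖` (`norm_gNew_clm_le`, `norm_gNew_apply_le`); for complete `E` the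
  vector form of (3.86) `G(U′U)J = Σ_n G(U)(V(A)G(U))^n J` convergent in `E` (`hasSum_gNew_apply`, `gNew_apply_eq_tsum`) and
  `(Δ_a − V)(gNew J) = J`, `gNew((Δ_a − V)J) = J` (`sub_gNew_apply`, `gNew_sub_apply`).
* §5 «This bound implies in particular …»: dropping the decay factor `e^{−δ₀d(y,y′)/2} ≤ 1` (`exp_decay_le_one`, `bound_drop_decay`).
* §6 sanity: `ℝ`, `Δ_a = 2`, `V = G = 1/2`: `gNew = (1/2)·Σ(1/4)^n = 2/3 = (Δ_a − V)^{−1}` (`gNew_real_example`).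

RELATED, NOT DUPLICATED.  `B8FromB9` §A (r1 lineage: fixed-point/Neumann algebra `x = J + Kx` on `F →L[ℝ] F`, the transfer
B9 ⇒ B8 — a different normal form and purpose); `B12HOperatorNeumann267` (`K − S = K(1 − K⁻¹S)`, LEFT factorisation for the
`H`-operator of B12 (2.67)); `B9.lean` (`SectBStepPrinted`/`thm34_of_sectB`: the Sect. B step BY REFERENCE, GAPS C-B9-1 names
«resolvent identities + Neumann series … (3.86)» as the mechanism — this file is that mechanism's kernel certificate for the
(3.82)–(3.86) instance, with by-reference inputs untouched); `B9Thm34Ext` (Theorem 3.4's extension clause); `B9Eq372Operator`,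
`B9Eq380Telescope` (this lineage: (3.71)/(3.75) and (3.80) themselves).  The elementary bound `‖(1 − x)⁻¹‖ ≤ (1 − ‖x‖)⁻¹` exists in
the tree (`T4OneStepFactorisation.norm_oneSub_inv_le`, root `norm_oneSub_inv_le` of `PseudospectralEnclosureNet`); it is not
imported (foreign cones) — the composite bounds here come straight from Mathlib's `tsum_geometric_le_of_norm_lt_one`.

NOT PROVED HERE (by design; binders or untouched): (3.71), (3.75), (3.68), (3.80) themselves; the bounds (3.73), (3.77),
(3.83), (3.85) and Theorem 3.3 (random-walk expansion) — in particular (3.85) ⟹ the sup-norm bound is used only in the shape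
«∀ J, ‖VGJ‖ ≤ cα₁‖J‖»; that `V₃(A)` satisfies (3.73) and the locality/semi-locality clauses; analyticity in `A` of `V₃, P₁, P₂`
and of the terms of the series; «convergence in all norms (3.42)–(3.47)» and the local bounds via Lemma 2.1 [4]; Theorem 3.4.
-/


namespace Literature.MathematicalPhysics.QuantumFieldTheory.Balaban1983to89.B9Eq386Neumann

open scoped Topology BigOperators

/-! ## §1 (3.76) as ring algebra -/

section Eq376

variable {R : Type*} [Ring R]

/-- `P₁(A)` of (3.76): `(D′−D)P D* + D P(D′*−D*) + (D′−D)P(D′*−D*) + D′P′(A)D′*` — «The operator P₁(A) was defined in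
(3.76). It is a non-local bounded operator» (binders `P = P(U)`, `Pp = P′(A)`). [folklore] [cite:
Balaban1985BackgroundPropagators, (3.76) p.405] -/
def pOne (D D' Ds Ds' P Pp : R) : R :=
  (D' - D) * P * Ds + D * P * (Ds' - Ds) + (D' - D) * P * (Ds' - Ds) + D' * Pp * Ds'

/-- (3.76), first printed equality: `D′R′D′* = DRD* − V₂ − (D′−D)PD* − DP(D′*−D*) − (D′−D)P(D′*−D*) − D′P′D′*`, from
(3.75) `D′D′* = DD* − V₂` (`h375`), «P(U) = I − R(U)» at `U` and `U′U` and (3.68) «P(U′U) = P(U) + P′(A)» (`hR`,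
`hR'`); pure ring algebra. [folklore] [cite: Balaban1985BackgroundPropagators, (3.76) p.405] -/
theorem eq376_line1 (D D' Ds Ds' Rr Rr' P Pp V₂ : R) (hR : Rr = 1 - P)
    (hR' : Rr' = 1 - (P + Pp)) (h375 : D' * Ds' = D * Ds - V₂) :
    D' * Rr' * Ds' = D * Rr * Ds - V₂ - (D' - D) * P * Ds - D * P * (Ds' - Ds)
      - (D' - D) * P * (Ds' - Ds) - D' * Pp * Ds' := by
  subst hR hR'
  have h1 : D' * (1 - (P + Pp)) * Ds' = D' * Ds' - D' * P * Ds' - D' * Pp * Ds' := by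
    noncomm_ring
  rw [h1, h375]
  noncomm_ring

/-- (3.76), second printed equality: `D′R′D′* = DRD* − V₂(A) − P₁(A)` with `P₁` = `pOne`. [folklore] [cite:
Balaban1985BackgroundPropagators, (3.76) p.405] -/
theorem eq376 (D D' Ds Ds' Rr Rr' P Pp V₂ : R) (hR : Rr = 1 - P)
    (hR' : Rr' = 1 - (P + Pp)) (h375 : D' * Ds' = D * Ds - V₂) :
    D' * Rr' * Ds' = D * Rr * Ds - V₂ - pOne D D' Ds Ds' P Pp := by
  rw [eq376_line1 D D' Ds Ds' Rr Rr' P Pp V₂ hR hR' h375, pOne]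
  noncomm_ring

/-- The two right-hand sides of (3.76) agree identically (definition of `P₁(A)`). [folklore] [cite:
Balaban1985BackgroundPropagators, (3.76) p.405] -/
theorem eq376_line1_eq_line2 (D D' Ds Ds' Rr P Pp V₂ : R) :
    D * Rr * Ds - V₂ - (D' - D) * P * Ds - D * P * (Ds' - Ds)
      - (D' - D) * P * (Ds' - Ds) - D' * Pp * Ds'
      = D * Rr * Ds - V₂ - pOne D D' Ds Ds' P Pp := by
  rw [pOne]; noncomm_ring

end Eq376

/-! ## §2 (3.82) and (3.84): the assembly and the factorisation -/

section Eq382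

variable {R : Type*} [Ring R]

/-- `Δ_a := D*D + Δ′ + DRD* + Q*aQ` — (3.26) «Δ_a = Δ + DRD* + Q*aQ» with «Δ(U′U) = D*_{U′U}D_{U′U} + Δ′(U′U)» (p.
404); four binders + `a`. [folklore] [cite: Balaban1985BackgroundPropagators, (3.26)-(3.27) p.395] -/
def deltaA (DsD Δp DRDs Qs a Q : R) : R := DsD + Δp + DRDs + Qs * a * Q

/-- `V₃(A) := V₁(A) − (Δ′(U′U) − Δ′(U)) + V₂(A)` (the sign convention forced by the third equality of (3.82)).
[folklore] [cite: Balaban1985BackgroundPropagators, (3.82) p.407] -/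
def vThree (V₁ V₂ Δp Δp' : R) : R := V₁ - (Δp' - Δp) + V₂

/-- `P₂(A) := −(F₂*(A)aQ(U) + Q*(U)aF₂(A) + F₂*(A)aF₂(A))` — «a sum of three terms obtained by the expansion of
averaging operators» (sign forced by the third equality of (3.82)). [folklore] [cite:
Balaban1985BackgroundPropagators, (3.82) p.407] -/
def pTwo (Qs Q F₂ F₂s a : R) : R := -(F₂s * a * Q + Qs * a * F₂ + F₂s * a * F₂)

/-- `V(A) := V₃(A) + P₁(A) + P₂(A)` — «Let us denote the sum of these three operators by V(A)». [folklore] [cite: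
Balaban1985BackgroundPropagators, (3.84) p.407] -/
def vTotal (V₃ P₁ P₂ : R) : R := V₃ + P₁ + P₂

/-- (3.82), first printed equality: `Δ_a(U′U) = D*_{U′U}D_{U′U} + Δ′(U′U) + D_{U′U}R(U′U)D*_{U′U} + Q*(U′U)aQ(U′U)`
(the definition (3.26) at `U′U`). [folklore] [cite: Balaban1985BackgroundPropagators, (3.82) p.407] -/
theorem eq382_line1 (DsD' Δp' DRDs' Qs' a Q' : R) :
    deltaA DsD' Δp' DRDs' Qs' a Q' = DsD' + Δp' + DRDs' + Qs' * a * Q' := rfl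

/-- Expansion of `Q*(U′U)aQ(U′U)` by (3.80): `(Q* + F₂*)a(Q + F₂) = Q*aQ + F₂*aQ + Q*aF₂ + F₂*aF₂`. [folklore] [cite:
Balaban1985BackgroundPropagators, (3.82) p.407] -/
theorem qStar_a_q_expand (Qs Q F₂ F₂s a Q' Qs' : R) (hQ : Q' = Q + F₂) (hQs : Qs' = Qs + F₂s) :
    Qs' * a * Q' = Qs * a * Q + F₂s * a * Q + Qs * a * F₂ + F₂s * a * F₂ := by
  subst hQ hQs; noncomm_ring

/-- (3.82), second printed equality: `Δ_a(U′U) = Δ_a(U) − V₁(A) + (Δ′(U′U) − Δ′(U)) − V₂(A) − P₁(A) + F₂*(A)aQ(U) +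
Q*(U)aF₂(A) + F₂*(A)aF₂(A)`, from (3.71) (`h371`), (3.76) (`h376`) and (3.80) (`h380`, `h380s`) as hypotheses.
[folklore] [cite: Balaban1985BackgroundPropagators, (3.82) p.407] -/
theorem eq382_line2 (DsD DsD' Δp Δp' DRDs DRDs' Qs Qs' Q Q' a V₁ V₂ P₁ F₂ F₂s : R)
    (h371 : DsD' = DsD - V₁) (h376 : DRDs' = DRDs - V₂ - P₁)
    (h380 : Q' = Q + F₂) (h380s : Qs' = Qs + F₂s) :
    deltaA DsD' Δp' DRDs' Qs' a Q'
      = deltaA DsD Δp DRDs Qs a Q - V₁ + (Δp' - Δp) - V₂ - P₁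
        + F₂s * a * Q + Qs * a * F₂ + F₂s * a * F₂ := by
  simp only [deltaA]
  rw [qStar_a_q_expand Qs Q F₂ F₂s a Q' Qs' h380 h380s, h371, h376]
  abel

/-- The second and third right-hand sides of (3.82) agree identically (definitions of `V₃`, `P₂`). [folklore] [cite:
Balaban1985BackgroundPropagators, (3.82) p.407] -/
theorem eq382_line2_eq_line3 (X Δp Δp' Qs Q a V₁ V₂ P₁ F₂ F₂s : R) :
    X - V₁ + (Δp' - Δp) - V₂ - P₁ + F₂s * a * Q + Qs * a * F₂ + F₂s * a * F₂
      = X - vThree V₁ V₂ Δp Δp' - P₁ - pTwo Qs Q F₂ F₂s a := by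
  simp only [vThree, pTwo]; abel

/-- (3.82), third printed equality: `Δ_a(U′U) = Δ_a(U) − V₃(A) − P₁(A) − P₂(A)`. [folklore] [cite:
Balaban1985BackgroundPropagators, (3.82) p.407] -/
theorem eq382 (DsD DsD' Δp Δp' DRDs DRDs' Qs Qs' Q Q' a V₁ V₂ P₁ F₂ F₂s : R)
    (h371 : DsD' = DsD - V₁) (h376 : DRDs' = DRDs - V₂ - P₁)
    (h380 : Q' = Q + F₂) (h380s : Qs' = Qs + F₂s) :
    deltaA DsD' Δp' DRDs' Qs' a Q'
      = deltaA DsD Δp DRDs Qs a Q - vThree V₁ V₂ Δp Δp' - P₁ - pTwo Qs Q F₂ F₂s a := by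
  rw [eq382_line2 DsD DsD' Δp Δp' DRDs DRDs' Qs Qs' Q Q' a V₁ V₂ P₁ F₂ F₂s h371 h376 h380 h380s,
    eq382_line2_eq_line3]

/-- (3.84), first equality: `Δ_a(U′U) = Δ_a(U) − V(A)` with `V = V₃ + P₁ + P₂`. [folklore] [cite:
Balaban1985BackgroundPropagators, (3.84) p.407] -/
theorem eq384_sub (DsD DsD' Δp Δp' DRDs DRDs' Qs Qs' Q Q' a V₁ V₂ P₁ F₂ F₂s : R)
    (h371 : DsD' = DsD - V₁) (h376 : DRDs' = DRDs - V₂ - P₁)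
    (h380 : Q' = Q + F₂) (h380s : Qs' = Qs + F₂s) :
    deltaA DsD' Δp' DRDs' Qs' a Q'
      = deltaA DsD Δp DRDs Qs a Q
        - vTotal (vThree V₁ V₂ Δp Δp') P₁ (pTwo Qs Q F₂ F₂s a) := by
  rw [eq382 DsD DsD' Δp Δp' DRDs DRDs' Qs Qs' Q Q' a V₁ V₂ P₁ F₂ F₂s h371 h376 h380 h380s, vTotal]
  abel

/-- (3.84), second equality: `Δ_a − V = (I − VG)Δ_a` GIVEN the left-inverse property `GΔ_a = 1` of `G = G(U)` (3.27) —
the hypothesis the print uses silently. [folklore] [cite: Balaban1985BackgroundPropagators, (3.84) p.407] -/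
theorem eq384_factor (Δa V G : R) (hG : G * Δa = 1) : Δa - V = (1 - V * G) * Δa := by
  rw [sub_mul, one_mul, mul_assoc, hG, mul_one]

/-- Right twin of (3.84): `Δ_a − V = Δ_a(I − GV)` given `Δ_aG = 1`. [folklore] [cite:
Balaban1985BackgroundPropagators, (3.84) p.407] -/
theorem eq384_factor_right (Δa V G : R) (hG : Δa * G = 1) : Δa - V = Δa * (1 - G * V) := by
  rw [mul_sub, mul_one, ← mul_assoc, hG, one_mul]

/-- The inverse property in (3.84) is load-bearing: for integers `Δ_a = 2`, `V = 1`, `G = 0` the factorisation `Δ_a −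
V = (1 − VG)Δ_a` fails (`1 ≠ 2`). [folklore] [cite: Balaban1985BackgroundPropagators, (3.84) p.407] -/
theorem eq384_factor_needs_inverse :
    ¬ ∀ (Δa V G : ℤ), Δa - V = (1 - V * G) * Δa := by
  intro h
  have := h 2 1 0
  norm_num at this

/-- `(Δ_a − V)G = 1 − VG` given the right-inverse property `Δ_aG = 1`. [folklore] [cite:
Balaban1985BackgroundPropagators, (3.84) p.407] -/
theorem sub_mul_G (Δa V G : R) (hG : Δa * G = 1) : (Δa - V) * G = 1 - V * G := by
  rw [sub_mul, hG]

end Eq382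

/-! ## §3 (3.86): the Neumann series in a normed ring -/

section Neumann

variable {R : Type*} [NormedRing R]

/-- `G(U′U) := G(U)·Σ_{n≥0}(V(A)G(U))^n` — the right-hand side of (3.86) (binders `G = G(U)`, `V = V(A)`; `∑'` is
Mathlib's `tsum`, whose value is the sum whenever the series converges, as it does for `‖VG‖ < 1` in a complete normed
ring). [folklore] [cite: Balaban1985BackgroundPropagators, (3.86) p.407] -/
noncomputable def gNew (G V : R) : R := G * ∑' n : ℕ, (V * G) ^ n

/-- Norm bound for (3.86): `‖G Σ(VG)^n‖ ≤ ‖G‖(‖1‖ − 1 + (1 − ‖VG‖)⁻¹)` for `‖VG‖ < 1` (no `‖1‖ = 1` assumed; Mathlib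
`tsum_geometric_le_of_norm_lt_one`). [folklore] [cite: Balaban1985BackgroundPropagators, (3.86) p.407] -/
theorem norm_gNew_le (G V : R) (h : ‖V * G‖ < 1) :
    ‖gNew G V‖ ≤ ‖G‖ * (‖(1 : R)‖ - 1 + (1 - ‖V * G‖)⁻¹) :=
  (norm_mul_le _ _).trans
    (mul_le_mul_of_nonneg_left (tsum_geometric_le_of_norm_lt_one _ h) (norm_nonneg _))

/-- `‖G Σ(VG)^n‖ ≤ ‖G‖/(1 − ‖VG‖)` when `‖1‖ ≤ 1` (operators). [folklore] [cite: Balaban1985BackgroundPropagators,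
(3.86) p.407] -/
theorem norm_gNew_le_of_norm_one_le (G V : R) (h : ‖V * G‖ < 1) (h1 : ‖(1 : R)‖ ≤ 1) :
    ‖gNew G V‖ ≤ ‖G‖ / (1 - ‖V * G‖) := by
  have := norm_gNew_le G V h
  rw [div_eq_mul_inv]
  refine this.trans (mul_le_mul_of_nonneg_left ?_ (norm_nonneg _))
  linarith

/-- `‖G Σ(VG)^n‖ ≤ ‖G‖/(1 − ‖VG‖)` in a norm-one class. [folklore] [cite: Balaban1985BackgroundPropagators, (3.86)
p.407] -/
theorem norm_gNew_le' [NormOneClass R] (G V : R) (h : ‖V * G‖ < 1) :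
    ‖gNew G V‖ ≤ ‖G‖ / (1 - ‖V * G‖) :=
  norm_gNew_le_of_norm_one_le G V h (le_of_eq NormOneClass.norm_one)

/-- «for α₁ sufficiently small» made explicit: `‖VG‖ ≤ cα₁` and `cα₁ < 1` give `‖VG‖ < 1`. [folklore] [cite:
Balaban1985BackgroundPropagators, (3.86) p.407] -/
theorem norm_lt_one_of_le_mul (x : R) (c α₁ : ℝ) (hx : ‖x‖ ≤ c * α₁) (hα : c * α₁ < 1) :
    ‖x‖ < 1 := lt_of_le_of_lt hx hα

/-- The explicit threshold: `0 < c` and `α₁ < c⁻¹` give `cα₁ < 1`. [folklore] [cite: Balaban1985BackgroundPropagators,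
(3.86) p.407] -/
theorem mul_lt_one_of_lt_inv (c α₁ : ℝ) (hc : 0 < c) (hα : α₁ < c⁻¹) : c * α₁ < 1 := by
  calc c * α₁ < c * c⁻¹ := mul_lt_mul_of_pos_left hα hc
    _ = 1 := mul_inv_cancel₀ hc.ne'

/-- Submultiplicativity `‖VG‖ ≤ ‖V‖‖G‖` (one way to make `VG` small). [folklore] [cite:
Balaban1985BackgroundPropagators, (3.86) p.407] -/
theorem norm_VG_le (V G : R) : ‖V * G‖ ≤ ‖V‖ * ‖G‖ := norm_mul_le _ _

/-- The Dirichlet restriction `X ↦ Ω₀XΩ₀` of (3.27) is additive: `Ω₀(X − V)Ω₀ = Ω₀XΩ₀ − Ω₀VΩ₀`, so «Δ_a(U′U) = Δ_a(U)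
− V(A)» descends to the restricted operators. [folklore] [cite: Balaban1985BackgroundPropagators, (3.26)-(3.27) p.395]
-/
theorem compress_sub {S : Type*} [Ring S] (e X V : S) :
    e * (X - V) * e = e * X * e - e * V * e := by
  rw [mul_sub, sub_mul]

variable [HasSummableGeomSeries R]

/-- The geometric series `Σ(VG)^n` converges for `‖VG‖ < 1` (normed ring with summable geometric series, e.g.
complete). [folklore] [cite: Balaban1985BackgroundPropagators, (3.86) p.407] -/
theorem summable_geom (G V : R) (h : ‖V * G‖ < 1) : Summable fun n : ℕ => (V * G) ^ n :=
  summable_geometric_of_norm_lt_one h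

/-- The series `Σ G(VG)^n` of (3.86) converges for `‖VG‖ < 1`. [folklore] [cite: Balaban1985BackgroundPropagators,
(3.86) p.407] -/
theorem summable_terms (G V : R) (h : ‖V * G‖ < 1) :
    Summable fun n : ℕ => G * (V * G) ^ n :=
  (summable_geometric_of_norm_lt_one h).mul_left G

/-- (3.86), second equality: `G(I − VG)^{−1} = G·Σ(VG)^n = Σ_n G(VG)^n`. [folklore] [cite:
Balaban1985BackgroundPropagators, (3.86) p.407] -/
theorem gNew_eq_tsum (G V : R) (h : ‖V * G‖ < 1) :
    gNew G V = ∑' n : ℕ, G * (V * G) ^ n := by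
  rw [gNew, ← (summable_geometric_of_norm_lt_one h).tsum_mul_left]

/-- «convergence is in the operator norm»: `Σ_n G(VG)^n` converges to `gNew` in the norm of `R`. [folklore] [cite:
Balaban1985BackgroundPropagators, (3.86) p.407] -/
theorem hasSum_gNew (G V : R) (h : ‖V * G‖ < 1) :
    HasSum (fun n : ℕ => G * (V * G) ^ n) (gNew G V) := by
  rw [gNew_eq_tsum G V h]
  exact (summable_terms G V h).hasSum

/-- The partial sums `Σ_{n<N} G(VG)^n` tend to `gNew` in norm. [folklore] [cite: Balaban1985BackgroundPropagators,
(3.86) p.407] -/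
theorem tendsto_partialSums (G V : R) (h : ‖V * G‖ < 1) :
    Filter.Tendsto (fun N : ℕ => ∑ n ∈ Finset.range N, G * (V * G) ^ n) Filter.atTop
      (𝓝 (gNew G V)) :=
  (hasSum_gNew G V h).tendsto_sum_nat

/-- (3.86), first equality: `gNew = G·(I − VG)^{−1}`, the inverse existing as a unit (`Units.oneSub`) for `‖VG‖ < 1`.
[folklore] [cite: Balaban1985BackgroundPropagators, (3.86) p.407] -/
theorem gNew_eq_mul_unit_inv (G V : R) (h : ‖V * G‖ < 1) :
    gNew G V = G * (↑(Units.oneSub (V * G) h)⁻¹ : R) := rfl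

/-- (3.86), first equality with `Ring.inverse`: `gNew = G·(1 − VG)⁻¹`. [folklore] [cite:
Balaban1985BackgroundPropagators, (3.86) p.407] -/
theorem gNew_eq_mul_inverse (G V : R) (h : ‖V * G‖ < 1) :
    gNew G V = G * Ring.inverse (1 - V * G) := by
  rw [gNew, geom_series_eq_inverse _ h]

/-- The unit of (3.86) is `I − V(A)G(U)`. [folklore] [cite: Balaban1985BackgroundPropagators, (3.86) p.407] -/
theorem unit_val (G V : R) (h : ‖V * G‖ < 1) : (↑(Units.oneSub (V * G) h) : R) = 1 - V * G :=
  Units.val_oneSub _ _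

/-- `(Δ_a − V)·G(U′U) = 1` given the right-inverse property `Δ_aG = 1`: `G(U′U)` is a right inverse of `Δ_a(U′U) = Δ_a
− V`. [folklore] [cite: Balaban1985BackgroundPropagators, (3.86) p.407] -/
theorem sub_mul_gNew (Δa V G : R) (hΔG : Δa * G = 1) (h : ‖V * G‖ < 1) :
    (Δa - V) * gNew G V = 1 := by
  rw [gNew, ← mul_assoc, sub_mul_G Δa V G hΔG, mul_neg_geom_series _ h]

/-- `G(U′U)·(Δ_a − V) = 1` given the left-inverse property `GΔ_a = 1` (via (3.84)). [folklore] [cite: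
Balaban1985BackgroundPropagators, (3.86) p.407] -/
theorem gNew_mul_sub (Δa V G : R) (hGΔ : G * Δa = 1) (h : ‖V * G‖ < 1) :
    gNew G V * (Δa - V) = 1 := by
  rw [eq384_factor Δa V G hGΔ, gNew, mul_assoc, ← mul_assoc (∑' n : ℕ, (V * G) ^ n),
    geom_series_mul_neg _ h, one_mul, hGΔ]

/-- `Δ_a(U′U) = Δ_a − V` is invertible (a unit with inverse `gNew`) when `G` is a two-sided inverse of `Δ_a` and `‖VG‖
< 1`. [folklore] [cite: Balaban1985BackgroundPropagators, (3.86) p.407] -/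
theorem isUnit_sub (Δa V G : R) (hΔG : Δa * G = 1) (hGΔ : G * Δa = 1) (h : ‖V * G‖ < 1) :
    IsUnit (Δa - V) :=
  ⟨⟨Δa - V, gNew G V, sub_mul_gNew Δa V G hΔG h, gNew_mul_sub Δa V G hGΔ h⟩, rfl⟩

/-- Uniqueness: any left inverse of `Δ_a − V` equals `gNew` — so «G(U′U)», THE inverse (3.27) at `U′U`, IS the series
(3.86). [folklore] [cite: Balaban1985BackgroundPropagators, (3.86) p.407] -/
theorem leftInverse_eq_gNew (Δa V G G' : R) (hΔG : Δa * G = 1) (h : ‖V * G‖ < 1)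
    (h' : G' * (Δa - V) = 1) : G' = gNew G V := by
  calc G' = G' * ((Δa - V) * gNew G V) := by rw [sub_mul_gNew Δa V G hΔG h, mul_one]
    _ = gNew G V := by rw [← mul_assoc, h', one_mul]

/-- Uniqueness, right version: any right inverse of `Δ_a − V` equals `gNew`. [folklore] [cite:
Balaban1985BackgroundPropagators, (3.86) p.407] -/
theorem rightInverse_eq_gNew (Δa V G G' : R) (hGΔ : G * Δa = 1) (h : ‖V * G‖ < 1)
    (h' : (Δa - V) * G' = 1) : G' = gNew G V := by
  calc G' = gNew G V * (Δa - V) * G' := by rw [gNew_mul_sub Δa V G hGΔ h, one_mul]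
    _ = gNew G V := by rw [mul_assoc, h', mul_one]

/-- `Ring.inverse (Δ_a − V) = gNew`: (3.86) as a statement about THE inverse. [folklore] [cite:
Balaban1985BackgroundPropagators, (3.86) p.407] -/
theorem inverse_sub_eq_gNew (Δa V G : R) (hΔG : Δa * G = 1) (hGΔ : G * Δa = 1)
    (h : ‖V * G‖ < 1) : Ring.inverse (Δa - V) = gNew G V := by
  obtain ⟨u, hu⟩ := isUnit_sub Δa V G hΔG hGΔ h
  rw [← hu, Ring.inverse_unit]
  apply leftInverse_eq_gNew Δa V G _ hΔG h
  rw [← hu]; exact u.inv_mul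

/-- (3.86) literally, for an invertible `Δ_a` with `G := Δ_a⁻¹`: `(Δ_a − V)⁻¹ = Δ_a⁻¹(1 − VΔ_a⁻¹)⁻¹` when `‖VΔ_a⁻¹‖ <
1`. [folklore] [cite: Balaban1985BackgroundPropagators, (3.86) p.407] -/
theorem eq386_inverse_form (Δa V : R) (hΔ : IsUnit Δa) (h : ‖V * Ring.inverse Δa‖ < 1) :
    Ring.inverse (Δa - V) = Ring.inverse Δa * Ring.inverse (1 - V * Ring.inverse Δa) := by
  rw [inverse_sub_eq_gNew Δa V (Ring.inverse Δa) (Ring.mul_inverse_cancel _ hΔ)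
    (Ring.inverse_mul_cancel _ hΔ) h, gNew_eq_mul_inverse _ _ h]

/-- `Σ(VG)^n − 1 = VG·Σ(VG)^n` (geometric shift). [folklore] [cite: Balaban1985BackgroundPropagators, (3.86) p.407] -/
theorem tsum_geom_sub_one (G V : R) (h : ‖V * G‖ < 1) :
    ∑' n : ℕ, (V * G) ^ n - 1 = V * G * ∑' n : ℕ, (V * G) ^ n := by
  have e := mul_neg_geom_series (V * G) h
  rw [sub_mul, one_mul] at e
  calc ∑' n : ℕ, (V * G) ^ n - 1
      = (∑' n : ℕ, (V * G) ^ n - V * G * ∑' n : ℕ, (V * G) ^ n)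
          + V * G * ∑' n : ℕ, (V * G) ^ n - 1 := by abel
    _ = V * G * ∑' n : ℕ, (V * G) ^ n := by rw [e]; abel

/-- Second resolvent identity for (3.84)/(3.86): `G(U′U) − G(U) = G(U)V(A)G(U′U)`. [folklore] [cite:
Balaban1985BackgroundPropagators, (3.86) p.407] -/
theorem gNew_sub_G (G V : R) (h : ‖V * G‖ < 1) :
    gNew G V - G = G * V * gNew G V := by
  have e : gNew G V - G = G * (∑' n : ℕ, (V * G) ^ n - 1) := by rw [mul_sub, mul_one, gNew]
  rw [e, tsum_geom_sub_one G V h, gNew]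
  simp only [mul_assoc]

/-- First-order closeness: `‖G(U′U) − G(U)‖ ≤ ‖G‖‖VG‖(‖1‖ − 1 + (1 − ‖VG‖)⁻¹)` (small with `α₁`). [folklore] [cite:
Balaban1985BackgroundPropagators, (3.86) p.407] -/
theorem norm_gNew_sub_G_le (G V : R) (h : ‖V * G‖ < 1) :
    ‖gNew G V - G‖ ≤ ‖G‖ * ‖V * G‖ * (‖(1 : R)‖ - 1 + (1 - ‖V * G‖)⁻¹) := by
  have e : gNew G V - G = G * (V * G) * ∑' n : ℕ, (V * G) ^ n := by
    rw [gNew_sub_G G V h, gNew]; simp only [mul_assoc]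
  rw [e]
  exact (norm_mul_le _ _).trans (mul_le_mul (norm_mul_le _ _)
    (tsum_geometric_le_of_norm_lt_one _ h) (norm_nonneg _)
    (mul_nonneg (norm_nonneg _) (norm_nonneg _)))

/-- Geometric tail of (3.86): `gNew − Σ_{n<N} G(VG)^n = G(VG)^N·Σ(VG)^n`. [folklore] [cite:
Balaban1985BackgroundPropagators, (3.86) p.407] -/
theorem gNew_sub_partial (G V : R) (h : ‖V * G‖ < 1) (N : ℕ) :
    gNew G V - ∑ n ∈ Finset.range N, G * (V * G) ^ n
      = G * (V * G) ^ N * ∑' n : ℕ, (V * G) ^ n := by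
  have hs := summable_terms G V h
  have htail : ∑' i : ℕ, G * (V * G) ^ (i + N) = G * (V * G) ^ N * ∑' n : ℕ, (V * G) ^ n := by
    rw [← (summable_geometric_of_norm_lt_one h).tsum_mul_left]
    refine tsum_congr fun i => ?_
    rw [add_comm, pow_add, mul_assoc]
  rw [← htail, gNew_eq_tsum G V h, ← hs.sum_add_tsum_nat_add N, add_sub_cancel_left]

/-- Rate of «convergence in the operator norm»: `‖gNew − Σ_{n<N} G(VG)^n‖ ≤ ‖G‖‖(VG)^N‖(‖1‖ − 1 + (1 − ‖VG‖)⁻¹)`.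
[folklore] [cite: Balaban1985BackgroundPropagators, (3.86) p.407] -/
theorem norm_gNew_sub_partial_le (G V : R) (h : ‖V * G‖ < 1) (N : ℕ) :
    ‖gNew G V - ∑ n ∈ Finset.range N, G * (V * G) ^ n‖
      ≤ ‖G‖ * ‖(V * G) ^ N‖ * (‖(1 : R)‖ - 1 + (1 - ‖V * G‖)⁻¹) := by
  rw [gNew_sub_partial G V h N]
  exact (norm_mul_le _ _).trans (mul_le_mul (norm_mul_le _ _)
    (tsum_geometric_le_of_norm_lt_one _ h) (norm_nonneg _)
    (mul_nonneg (norm_nonneg _) (norm_nonneg _)))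

end Neumann

/-! ## §4 continuous linear operators: sup-norm smallness and the vector form of (3.86) -/

section Operators

variable {𝕜 E : Type*} [NontriviallyNormedField 𝕜] [NormedAddCommGroup E] [NormedSpace 𝕜 E]

/-- «This bound implies in particular the bound |V(A)G(U)J| ≤ O(1)α₁|J|, hence V(A)G(U) is a small operator in
supremum norm»: a pointwise bound for all `J` is an operator-norm bound `‖VG‖ ≤ O(1)α₁`. [folklore] [cite:
Balaban1985BackgroundPropagators, (3.85) p.407] -/
theorem opNorm_le_of_pointwise (T : E →L[𝕜] E) (c α₁ : ℝ) (hc : 0 ≤ c * α₁)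
    (hT : ∀ J : E, ‖T J‖ ≤ c * α₁ * ‖J‖) : ‖T‖ ≤ c * α₁ :=
  ContinuousLinearMap.opNorm_le_bound _ hc hT

/-- … and `‖VG‖ < 1` once `O(1)α₁ < 1`. [folklore] [cite: Balaban1985BackgroundPropagators, (3.85) p.407] -/
theorem opNorm_lt_one_of_pointwise (T : E →L[𝕜] E) (c α₁ : ℝ) (hc : 0 ≤ c * α₁)
    (hα : c * α₁ < 1) (hT : ∀ J : E, ‖T J‖ ≤ c * α₁ * ‖J‖) : ‖T‖ < 1 :=
  lt_of_le_of_lt (opNorm_le_of_pointwise T c α₁ hc hT) hα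

/-- `‖I‖ ≤ 1` for continuous linear operators (`= 1` unless `E` is trivial). [folklore] [cite:
Balaban1985BackgroundPropagators, (3.86) p.407] -/
theorem norm_one_clm_le : ‖(1 : E →L[𝕜] E)‖ ≤ 1 := by
  rw [ContinuousLinearMap.one_def]; exact ContinuousLinearMap.norm_id_le

/-- Operators: `‖G(U′U)‖ ≤ ‖G(U)‖/(1 − ‖V(A)G(U)‖)`. [folklore] [cite: Balaban1985BackgroundPropagators, (3.86) p.407]
-/
theorem norm_gNew_clm_le (G V : E →L[𝕜] E) (h : ‖V * G‖ < 1) :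
    ‖gNew G V‖ ≤ ‖G‖ / (1 - ‖V * G‖) :=
  norm_gNew_le_of_norm_one_le G V h norm_one_clm_le

/-- Operators, applied: `‖G(U′U)J‖ ≤ ‖G(U)‖/(1 − ‖V(A)G(U)‖)·‖J‖`. [folklore] [cite: Balaban1985BackgroundPropagators,
(3.86) p.407] -/
theorem norm_gNew_apply_le (G V : E →L[𝕜] E) (h : ‖V * G‖ < 1) (J : E) :
    ‖gNew G V J‖ ≤ ‖G‖ / (1 - ‖V * G‖) * ‖J‖ :=
  (ContinuousLinearMap.le_opNorm _ _).trans
    (mul_le_mul_of_nonneg_right (norm_gNew_clm_le G V h) (norm_nonneg _))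

variable [CompleteSpace E]

/-- Vector form of (3.86) on a Banach space: `G(U′U)J = Σ_n G(U)(V(A)G(U))^n J`, convergent in `E`. [folklore] [cite:
Balaban1985BackgroundPropagators, (3.86) p.407] -/
theorem hasSum_gNew_apply (G V : E →L[𝕜] E) (h : ‖V * G‖ < 1) (J : E) :
    HasSum (fun n : ℕ => G (((V * G) ^ n) J)) (gNew G V J) := by
  have := (hasSum_gNew G V h).map (ContinuousLinearMap.apply 𝕜 E J)
    (ContinuousLinearMap.apply 𝕜 E J).continuous
  simpa [Function.comp_def] using this

/-- Vector form of (3.86) as a `tsum`. [folklore] [cite: Balaban1985BackgroundPropagators, (3.86) p.407] -/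
theorem gNew_apply_eq_tsum (G V : E →L[𝕜] E) (h : ‖V * G‖ < 1) (J : E) :
    gNew G V J = ∑' n : ℕ, G (((V * G) ^ n) J) :=
  (hasSum_gNew_apply G V h J).tsum_eq.symm

/-- `(Δ_a − V)(G(U′U)J) = J` given `Δ_aG = 1`. [folklore] [cite: Balaban1985BackgroundPropagators, (3.86) p.407] -/
theorem sub_gNew_apply (Δa V G : E →L[𝕜] E) (hΔG : Δa * G = 1) (h : ‖V * G‖ < 1) (J : E) :
    (Δa - V) (gNew G V J) = J := by
  have := congrArg (fun T : E →L[𝕜] E => T J) (sub_mul_gNew Δa V G hΔG h)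
  simpa using this

/-- `G(U′U)((Δ_a − V)J) = J` given `GΔ_a = 1`. [folklore] [cite: Balaban1985BackgroundPropagators, (3.86) p.407] -/
theorem gNew_sub_apply (Δa V G : E →L[𝕜] E) (hGΔ : G * Δa = 1) (h : ‖V * G‖ < 1) (J : E) :
    gNew G V ((Δa - V) J) = J := by
  have := congrArg (fun T : E →L[𝕜] E => T J) (gNew_mul_sub Δa V G hGΔ h)
  simpa using this

end Operators

/-! ## §5 «This bound implies in particular …»: dropping the decay factor of (3.85) -/

section Decay

/-- `e^{−δ₀d/2} ≤ 1` for `δ₀, d ≥ 0`. [folklore] [cite: Balaban1985BackgroundPropagators, (3.85) p.407] -/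
theorem exp_decay_le_one (δ₀ dist : ℝ) (hδ : 0 ≤ δ₀) (hd : 0 ≤ dist) :
    Real.exp (-(1 / 2) * δ₀ * dist) ≤ 1 := by
  rw [Real.exp_le_one_iff]
  have := mul_nonneg hδ hd
  nlinarith

/-- «This bound implies in particular …»: a bound `x ≤ cα₁e^{−δ₀d/2}M` with `cα₁, M, δ₀, d ≥ 0` gives `x ≤ cα₁M` (the
decay factor of (3.85) dropped). [folklore] [cite: Balaban1985BackgroundPropagators, (3.85) p.407] -/
theorem bound_drop_decay (x c α₁ δ₀ dist M : ℝ) (hc : 0 ≤ c * α₁) (hM : 0 ≤ M)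
    (hδ : 0 ≤ δ₀) (hd : 0 ≤ dist)
    (hx : x ≤ c * α₁ * Real.exp (-(1 / 2) * δ₀ * dist) * M) : x ≤ c * α₁ * M := by
  refine hx.trans ?_
  have := exp_decay_le_one δ₀ dist hδ hd
  calc c * α₁ * Real.exp (-(1 / 2) * δ₀ * dist) * M
      ≤ c * α₁ * 1 * M := by
        apply mul_le_mul_of_nonneg_right _ hM
        exact mul_le_mul_of_nonneg_left this hc
    _ = c * α₁ * M := by ring

end Decay

/-! ## §6 sanity instances -/

section Sanity

example : deltaA (1 : ℤ) 2 3 4 5 6 = 1 + 2 + 3 + 4 * 5 * 6 := rfl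

/-- Sanity (ℝ): `Δ_a = 2`, `V = G = 1/2`: `gNew = (1/2)Σ(1/4)^n = 2/3 = (Δ_a − V)^{−1}`. [folklore] [cite:
Balaban1985BackgroundPropagators, (3.86) p.407] -/
theorem gNew_real_example : gNew (1 / 2 : ℝ) (1 / 2) = 2 / 3 := by
  rw [gNew]
  have h : ‖((1 : ℝ) / 2 * (1 / 2))‖ < 1 := by norm_num
  rw [tsum_geometric_of_norm_lt_one h]
  norm_num

example : ((2 : ℝ) - 1 / 2) * (2 / 3) = 1 := by norm_num

end Sanity

end Literature.MathematicalPhysics.QuantumFieldTheory.Balaban1983to89.B9Eq386Neumann
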